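import Literature.NumberTheory.PAdicHodge.BmaxPlusToBdRPeriods
import Literature.NumberTheory.PAdicHodge.BdRPlusFormalLogTheta
import HarnessLib

/-!
# `θ(b_ω) = p·log_ω(P)` for the φ-road's integrating element `b_ω = bmaxPlusToBdR (Λ_1(ι[ũ], z))`

Topic `Literature/NumberTheory/PAdicHodge`; namespace `Literature.NumberTheory.PAdicHodge.AinfTop`. THEOREMS ONLY (no definition, no named
fact, no instance, no `sorry`). Item (iii) of the B8b list of memo
`Summits/…/Cruxes/StarredOptimalManinUnitFiveSeven/Lines/kato-lever-K2-tower-instantiation.md` §6 (line `kato_lever`, crux K★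
`stmt-BirchSwinnertonDyer-22226`): for a `[p]_W`-division sequence `u` of a point `P = P(u₀)` with `‖u₀‖ ≤ ‖p‖` (so `[ũ] ∈ (p, ξ)𝔸_inf`, index `N = 1`),
the honest `B_dR⁺`-image `b_ω = bmaxPlusToBdR (Λ_1(ι[ũ], z))` of the `A_max`-period is `p·L′` with `L′` THE value of `log_W(ι[ũ])` modulo every `Fil^k`
(`BmaxPlusToBdRPeriods`), and `θ(L′) = log_ω(P(u₀))` (`BdRPlusFormalLogTheta.IsFormalLogModFil.thetaBdR_eq_padicLogPointFiniteExt_ptOfZ`):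

* ★ `thetaBdR_bmaxPlusToBdR_logSum_divisionLiftPt` — **`θ_dR(b_ω) = p · log_ω(P(u₀))`** (the classical `p`-adic logarithm `padicLogPointFiniteExt` of the
  point of `E₁(ℂ_F)` with parameter `u₀`), the hypothesis `hθb : θ(b_ω) = ι(c_P)` of the socket's capstone with `c_P = p·log_ω P`.

Infrastructure only; BSD / K★ are not proved by any of this.

## References
* J.-M. Fontaine, *Formes différentielles et modules de Tate…*, Invent. Math. 65 (1982), §5. [Fontaine1982FormesDifferentielles]
* J. H. Silverman, *The Arithmetic of Elliptic Curves* (2009), Thm. IV.6.4, Prop. VII.2.2. [SilvermanAEC2009]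
-/

noncomputable section

open Ideal WittVector ValuativeRel Field

namespace Literature.NumberTheory.PAdicHodge

namespace AinfTop

open Literature.NumberTheory.GaloisRepresentations Literature.NumberTheory.GaloisRepresentations.IsNonarchimedeanLocalField
open Literature.NumberTheory.GaloisRepresentations.LubinTate Literature.NumberTheory.EllipticCurves
open Literature.NumberTheory.EllipticCurves.FormalGroupChart
open Literature.RingTheory.FormalGroups Literature.AlgebraicGeometry.Resolution GaloisContinuity

variable {F : Type} [Field F] [ValuativeRel F] [TopologicalSpace F] [IsNonarchimedeanLocalField F]
  [CharZero F] {p : ℕ} [Fact p.Prime] [Fact (¬ IsUnit (p : integerC F))]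
  [IsAdicComplete (Ideal.span {(p : integerC F)}) (integerC F)]
  {hθ : Function.Surjective (fontaineTheta (integerC F) p)} (W : WeierstrassCurve ℤ)

set_option maxHeartbeats 1600000 in
/-- ★ **`θ_dR(b_ω) = p · log_ω(P(u₀))`.** For a `[p]_W`-division sequence `u` of points of `Ŵ(𝔪_{ℂ_F})` with `‖u₀‖ ≤ ‖p‖` and any witness `ι[ũ] = p·z` in `B⁰_max`,
the honest image `b_ω = bmaxPlusToBdR (Λ_1(ι[ũ], z))` of the `A_max`-period satisfies
`θ_dR(b_ω) = p · padicLogPointFiniteExt (P(u₀))` — the classical `p`-adic elliptic logarithm of the point of `E₁(ℂ_F)` with parameter `u₀`.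
[cite: Fontaine1982FormesDifferentielles, §5] [cite: SilvermanAEC2009, Thm. IV.6.4 with Prop. VII.2.2] -/
theorem thetaBdR_bmaxPlusToBdR_logSum_divisionLiftPt (hp : valuation F p < 1) [(curveOver (CompletedAlgClosure F) W).IsElliptic]
    {u : ℕ → (maxNilIdealC F).toIdeal} (hup : ∀ n, mulPC F p W (u (n + 1)) = u n)
    (hu : ‖(((u 0 : (maxNilIdealC F).toIdeal) : CBall F) : CompletedAlgClosure F)‖ ≤ ‖(p : CompletedAlgClosure F)‖)
    {z : bmaxZero F p}
    (hz : algebraMap (Ainf (p := p) F) (bmaxZero F p)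
        ((of F p).symm (((divisionLiftPt W hθ u hup).val : (nilTheta F p hθ).toIdeal) : AinfTop F p)) ^ 1 = (p : bmaxZero F p) * z) :
    thetaBdR (bmaxPlusToBdR F p
      (PadicLogSeries.logSum ((algebraMap (Ainf (p := p) F) (bmaxZero F p)).comp zpToAinf) (GaloisContinuity.formalLogNum W p) 1
        (algebraMap (Ainf (p := p) F) (bmaxZero F p)
          ((of F p).symm (((divisionLiftPt W hθ u hup).val : (nilTheta F p hθ).toIdeal) : AinfTop F p))) z)) =
      (p : CompletedAlgClosure F) *
        padicLogPointFiniteExt (NormedField.valuation (K := CompletedAlgClosure F)) (curveOver (CompletedAlgClosure F) W) p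
          (ptOfZ (CompletedAlgClosure F) W (u 0)) := by
  obtain ⟨L', hL'eq, hL'⟩ := exists_forall_isFormalLogModFil_bmaxPlusToBdR_logSum W le_rfl
    ((of F p).symm (((divisionLiftPt W hθ u hup).val : (nilTheta F p hθ).toIdeal) : AinfTop F p)) hz
  have hθL' := IsFormalLogModFil.thetaBdR_eq_padicLogPointFiniteExt_ptOfZ (hθ := hθ) hp W le_rfl hup hu (hL' 1)
  rw [← hL'eq, pow_one, map_mul, map_natCast, hθL']

end AinfTop

end Literature.NumberTheory.PAdicHodge

end
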